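import Summits.QuantumFields.BalabanUV.T4Continuum.Support.VariationalColourTaxiTransport

/-!
# T⁴ programme, spine node NE2 (U1a), lane P2 — SUPPLIER ITEM «V-COL-TAXI», part 2: LINES, FACES AND FRAMES AT TAXI DATA — the iterated in-block step,
# the FACE-CROSSING defect against the straight coarsening, and Bałaban's product LINE transports against the FRAME-ADAPTED ones, all from the operator
# plaquette defect alone; the in-block ∕ crossing binders of UB⁺-colour and ONE⁺-colour in their own (adjoint) letters for unitary data

NE2 formalisation swarm `b2b-balaban-t4-ne2-formalise-*`, leaf prover 04 GEN 4 (`prover-b2b-balaban-t4-ne2-formalise-leaf-04-g4-0`); register row «P2-sup» of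
`t4/formal/NE2/LEAVES.md`; journal CLAIMS.log «V-COL-TAXI part 2».  On top of part 1 `VariationalColourTaxiTransport` (`taxiTv`, `coarseTv`,
`inBlock_defect_taxiTv_le`, `coarse_mul_taxiAcc_sub_le`, `norm_misv_taxi_le`) BY NAME; the operator twin of this lineage's U(1) `VariationalTaxiCoarseBinders`.

THE POINT.  Through a fine point `p` of block `y + e_ν` pass `ν`-lines started in block `y + e_ν` (OWN lines) and `ν`-lines started in block `y` (SPILL lines);
Bałaban's product line transport `lineT T′ R′ y j t ν = T′(L·y+j) ∘ Π^ν_t(L·y+j)` ([Balaban1985AveragingOperations] (125) SHAPE) carries `p` back to the base point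
of the STARTING block, so against a POINT reference the spill lines are off by a whole coarse bond — the located design remark N-ne2leaf02g4-1 ∕ leaf-01-g6's
FRAME-ADAPTED class (`U′(p)` on own points, `Rc(y,ν) ∘ U′(p)` on spill points).  AT TAXI DATA (`T′ = taxiTv R′`, `Rc = coarseTv R′`, frames `U′ = taxiTv R′`) the
product line transports ARE frame-adapted up to `3·(d−1)·L·(L−1)·a`, with NO small-field hypothesis:
 * §1 `piTv_of_succ_eq`, `bpt_update_add` (point bookkeeping); **`taxiTv_steps_sub_le`** (part 1's `μ`-step iterated `s` times inside the block):
   `j_μ + s < L → ‖taxiTv R′ (L·y+j+s e_μ) − taxiTv R′ (L·y+j) ∘ Π^μ_s(L·y+j)‖ ≤ s·(d−1)(L−1)·a`;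
 * §2 `coarseTv_plaq_le` (the coarse data inherit the plaquette class: defect `≤ L²·a`); **`cross_defect_taxiTv_le`** (THE FACE): `j_μ + 1 = L → ‖coarseTv R′ y μ ∘ taxiTv R′ (L·y+j+e_μ) − taxiTv R′ (L·y+j) ∘ R′(L·y+j, μ)‖ ≤ (d−1)(L−1)(2L−1)·a`
   (part 1's `L`-run lemma at the digits `j[μ ↦ 0]`, then `L − 1` in-block steps back);
 * §3 LINES vs FRAMES: **`lineT_taxi_own_sub_le`** (`j_ν + t < L`: `‖lineT y j t ν − taxiTv R′ p‖ ≤ (d−1)L(L−1)·a`) and **`lineT_taxi_spill_sub_le`**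
   (`L ≤ j_ν + t`: `‖lineT y j t ν − coarseTv R′ y ν ∘ taxiTv R′ p‖ ≤ 3·(d−1)L(L−1)·a`), `p = L·y + j + t e_ν` — the `γ` of leaf-01-g6's V-ONE-1F file 4 and of a
   frame-relative V-UB-L at taxi data;
 * §4 UNITARY DATA on a Hilbert space (adjoints as inverses): UB⁺-colour's `hw` (`VariationalColourUpperBound.blockSpin_colour_le_of_unitary`), ONE⁺-colour's
   `hin` ∕ `hcross` (`VariationalColourOneStep.sum_dirUv_interpv_le`, star letters) DISCHARGED at taxi data with `w = m_in = (d−1)(L−1)·a`,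
   `m_cross = (d−1)(L−1)(2L−1)·a` — the same `hw` shape is leaf-09-g6's V-P binder (`VariationalVectorGarding.qWV_le_line_of_divControl`) and leaf-01-g5's
   V-P CORE (i) binder; FED⁺-colour's `m` is part 1's `norm_misv_taxi_le`.
WHAT IS NOT HERE (stated, not hidden): those leaves' ENDs re-run at taxi data (one-liners for their holders ∕ the colour assembly), the frame-relative V-UB-L
itself, V-ONE-1F (leaf-01-g6), the `G`-half (V-GF), the operator nested tower, the END (road owner).

HONEST FRAMING (T4-DAG p. 1).  A model-level DICTIONARY between hypothesis sets of OUR leaves; bond operators DATA on a normed ℂ-space (unitary on a Hilbert space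
in §4); taxi ∕ straight contours OURS ([Balaban1985BackgroundPropagators] (3.10) ∕ (3.15) ∕ (3.19) SHAPES only — no B0, c5); [folklore] ordered-product
bookkeeping; nothing printed is a hypothesis; no `def`, no `def … : Prop`, no `sorry`; axioms standard.  NE2 NOT proved on either road; NE3 OPEN; spine PROVED 0∕9
unchanged; rung (B)+1 finite T⁴ — NOT infinite volume, NOT mass gap, NOT Clay.  HONEST DEPENDENCY (cell, verbatim): continuum YM on T⁴ ⇐ BetaPertH ∧ nine spine
estimates (0/9 proved); BetaPertH ⇐ (D1) ∧ (D4) ∧ CAP+tail; G-an2-4 gates asym, D1 and NE2/3/4.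
-/

noncomputable section

namespace Summit.QuantumFields.BalabanUV.T4Continuum.VariationalColourTaxiTransport

open Literature.MathematicalPhysics.QuantumFieldTheory.Balaban1983to89.B5Prop11Plancherel (Tor fine unitVec)
open Literature.MathematicalPhysics.QuantumFieldTheory.Balaban1983to89.B5Block118 (tstep tstep_zero tstep_succ bpt bpt_add_tstep)
open Literature.MathematicalPhysics.QuantumFieldTheory.Balaban1983to89.B5Blocks16 (blockOf blockOf_bpt)
open Summit.QuantumFields.BalabanUV.T4Continuum.ScalarBlockTrialFunction (digits digits_bpt bpt_add_unitVec_of_lt bpt_add_unitVec_of_eq bpt_update')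
open Summit.QuantumFields.BalabanUV.T4Continuum.VariationalTaxiTransport (corner corner_d)
open Summit.QuantumFields.BalabanUV.T4Continuum.VariationalColourFederbush (piTv norm_piTv_le_one norm_le_one_of_mem_unitary)
open Summit.QuantumFields.BalabanUV.T4Continuum.VariationalVectorFederbush (lineT norm_piTv_comm_sub_le)

variable {d : ℕ} {E : Type*} [NormedAddCommGroup E] [NormedSpace ℂ E]

/-! ## §1 Point bookkeeping and the iterated in-block step -/

section Steps

variable (L : ℕ) [NeZero L] (N : Fin d → ℕ) [hN : ∀ μ, NeZero (N μ)]

omit [NeZero L] hN in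
/-- the last bond of a straight transporter: `t + 1 = T → Π_T(x) = Π_t(x) ∘ R′(x + t e_μ, μ)`. [folklore] -/
theorem piTv_of_succ_eq (R' : Tor (fine L N) → Fin d → (E →L[ℂ] E)) (x : Tor (fine L N)) (μ : Fin d) {t T : ℕ} (h : t + 1 = T) :
    piTv L N R' x μ T = piTv L N R' x μ t * R' (x + tstep (fine L N) μ t) μ := by
  subst h; rfl

omit hN in
/-- moving the `μ`-digit up by `s` is the translation by `s e_μ`: `L·y + j[μ ↦ j_μ + s] = L·y + j + s e_μ`. [folklore] -/
theorem bpt_update_add (y : Tor N) (j : Fin d → Fin L) (μ : Fin d) {s : ℕ} (hs : (j μ : ℕ) + s < L) :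
    bpt L N y (Function.update j μ ⟨(j μ : ℕ) + s, hs⟩) = bpt L N y j + tstep (fine L N) μ s := by
  have h1 : bpt L N y j = bpt L N y (Function.update j μ 0) + tstep (fine L N) μ (j μ : ℕ) := by
    conv_lhs => rw [← Function.update_eq_self μ j]
    exact bpt_update' L N y j μ (j μ)
  rw [bpt_update', h1, add_assoc, ← VectorBlockTrialForm.tstep_add L N μ (j μ : ℕ) s]

omit hN in
/-- resetting the `μ`-digit: `L·y + j = L·y + j[μ ↦ 0] + j_μ e_μ`. [folklore] -/
theorem bpt_eq_update_zero_add (y : Tor N) (j : Fin d → Fin L) (μ : Fin d) :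
    bpt L N y j = bpt L N y (Function.update j μ 0) + tstep (fine L N) μ (j μ : ℕ) := by
  conv_lhs => rw [← Function.update_eq_self μ j]
  exact bpt_update' L N y j μ (j μ)

variable {R' : Tor (fine L N) → Fin d → (E →L[ℂ] E)} (hR' : ∀ x μ, ‖R' x μ‖ ≤ 1) {a : ℝ}
  (ha : ∀ x κ ι, ‖R' x κ * R' (x + unitVec (fine L N) κ) ι - R' x ι * R' (x + unitVec (fine L N) ι) κ‖ ≤ a)
include hR' ha

/-- **THE ITERATED IN-BLOCK STEP**: `j_μ + s < L → ‖taxiTv R′ (L·y + j + s e_μ) − taxiTv R′ (L·y + j) ∘ Π^μ_s(L·y + j)‖ ≤ s·(d−1)(L−1)·a`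
(part 1's `inBlock_defect_taxiTv_le` `s` times, `Π_{s+1} = Π_s ∘ R′`). [folklore] -/
theorem taxiTv_steps_sub_le (y : Tor N) (j : Fin d → Fin L) (μ : Fin d) :
    ∀ (s : ℕ) (hs : (j μ : ℕ) + s < L),
      ‖taxiTv L N R' (bpt L N y j + tstep (fine L N) μ s) - taxiTv L N R' (bpt L N y j) * piTv L N R' (bpt L N y j) μ s‖
        ≤ s * (((d - 1 : ℕ) : ℝ) * ((L - 1 : ℕ) : ℝ) * a)
  | 0, _ => by simp [piTv, tstep_zero]
  | s + 1, hs => by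
    have hs' : (j μ : ℕ) + s < L := by omega
    have ih := taxiTv_steps_sub_le y j μ s hs'
    have hpt := bpt_update_add L N y j μ hs'
    set js : Fin d → Fin L := Function.update j μ ⟨(j μ : ℕ) + s, hs'⟩ with hjs_def
    have hjs : ((js μ : ℕ)) + 1 < L := by simp [hjs_def]; omega
    have hstep := inBlock_defect_taxiTv_le L N hR' ha y js μ hjs
    rw [hpt] at hstep
    rw [tstep_succ, ← add_assoc]
    -- `Π_{s+1}(b) = Π_s(b) ∘ R′(b + s e_μ, μ)` and insert `taxiTv (b + s e_μ) ∘ R′(b + s e_μ, μ)`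
    have e : taxiTv L N R' (bpt L N y j + tstep (fine L N) μ s + unitVec (fine L N) μ)
          - taxiTv L N R' (bpt L N y j) * piTv L N R' (bpt L N y j) μ (s + 1)
        = (taxiTv L N R' (bpt L N y j + tstep (fine L N) μ s + unitVec (fine L N) μ)
            - taxiTv L N R' (bpt L N y j + tstep (fine L N) μ s) * R' (bpt L N y j + tstep (fine L N) μ s) μ)
          + (taxiTv L N R' (bpt L N y j + tstep (fine L N) μ s) - taxiTv L N R' (bpt L N y j) * piTv L N R' (bpt L N y j) μ s)
            * R' (bpt L N y j + tstep (fine L N) μ s) μ := by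
      simp only [piTv, sub_mul, mul_assoc]; abel
    rw [e]
    have ha0 : 0 ≤ a := (norm_nonneg _).trans (ha (bpt L N y j) μ μ)
    calc _ ≤ ‖taxiTv L N R' (bpt L N y j + tstep (fine L N) μ s + unitVec (fine L N) μ)
            - taxiTv L N R' (bpt L N y j + tstep (fine L N) μ s) * R' (bpt L N y j + tstep (fine L N) μ s) μ‖
          + ‖(taxiTv L N R' (bpt L N y j + tstep (fine L N) μ s) - taxiTv L N R' (bpt L N y j) * piTv L N R' (bpt L N y j) μ s)
            * R' (bpt L N y j + tstep (fine L N) μ s) μ‖ := norm_add_le _ _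
      _ ≤ ((d - 1 : ℕ) : ℝ) * ((L - 1 : ℕ) : ℝ) * a + s * (((d - 1 : ℕ) : ℝ) * ((L - 1 : ℕ) : ℝ) * a) * 1 :=
          add_le_add hstep ((norm_mul_le _ _).trans (mul_le_mul ih (hR' _ _) (norm_nonneg _) (by positivity)))
      _ = ((s + 1 : ℕ) : ℝ) * (((d - 1 : ℕ) : ℝ) * ((L - 1 : ℕ) : ℝ) * a) := by push_cast; ring

/-! ## §2 The face: crossing into the next block against the straight coarsening -/

/-- **THE FACE-CROSSING DEFECT OF TAXI DATA**: `j_μ + 1 = L →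
‖coarseTv R′ y μ ∘ taxiTv R′ (L·y + j + e_μ) − taxiTv R′ (L·y + j) ∘ R′(L·y + j, μ)‖ ≤ (d−1)(L−1)(2L−1)·a` — the coarse bond followed by the next block's taxi
versus this block's taxi followed by the crossing fine bond (part 1's `L`-run across the taxi at the digits `j[μ ↦ 0]`, an `(d−1)·L(L−1)` plaquette budget, then
`L − 1` in-block steps back to `j`, `(L−1)·(d−1)(L−1)` more). [folklore] -/
theorem cross_defect_taxiTv_le (y : Tor N) (j : Fin d → Fin L) (μ : Fin d) (h : (j μ : ℕ) + 1 = L) :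
    ‖coarseTv L N R' y μ * taxiTv L N R' (bpt L N y j + unitVec (fine L N) μ) - taxiTv L N R' (bpt L N y j) * R' (bpt L N y j) μ‖
      ≤ ((d - 1 : ℕ) : ℝ) * ((L - 1 : ℕ) : ℝ) * ((2 * L - 1 : ℕ) : ℝ) * a := by
  have ha0 : 0 ≤ a := (norm_nonneg _).trans (ha (bpt L N y j) μ μ)
  set j0 : Fin d → Fin L := Function.update j μ 0 with hj0
  -- the points: across the face, and back from `j[μ ↦ 0]`
  have hface : bpt L N y j + unitVec (fine L N) μ = bpt L N (y + unitVec N μ) j0 := bpt_add_unitVec_of_eq L N y j μ h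
  have hback : bpt L N y j = bpt L N y j0 + tstep (fine L N) μ (L - 1) := by
    rw [bpt_eq_update_zero_add L N y j μ, show (j μ : ℕ) = L - 1 by omega]
  -- part 1's `L`-run across the whole taxi at digits `j0`
  have hrun := coarse_mul_taxiAcc_sub_le L N hR' ha y j0 μ le_rfl
  rw [if_pos μ.is_lt, corner_d] at hrun
  -- the last bond of the run and the `L − 1` steps back
  have hj0μ : ((j0 μ : ℕ)) + (L - 1) < L := by
    simp [hj0]; have := NeZero.pos L; omega
  have hsteps := taxiTv_steps_sub_le L N hR' ha y j0 μ (L - 1) hj0μ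
  rw [← hback] at hsteps
  have hlast : piTv L N R' (bpt L N y j0) μ L = piTv L N R' (bpt L N y j0) μ (L - 1) * R' (bpt L N y j) μ := by
    rw [piTv_of_succ_eq L N R' (bpt L N y j0) μ (show L - 1 + 1 = L by have := NeZero.pos L; omega), ← hback]
  rw [hface, taxiTv_bpt, taxiTv_bpt]
  rw [taxiTv_bpt, taxiTv_bpt] at hsteps
  unfold coarseTv
  -- insert `taxiAcc y j0 d ∘ Π_L(L·y + j0)`
  have e : piTv L N R' (bpt L N y 0) μ L * taxiAcc L N R' (y + unitVec N μ) j0 d - taxiAcc L N R' y j d * R' (bpt L N y j) μ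
      = (piTv L N R' (bpt L N y 0) μ L * taxiAcc L N R' (y + unitVec N μ) j0 d - taxiAcc L N R' y j0 d * piTv L N R' (bpt L N y j0) μ L)
        - (taxiAcc L N R' y j d - taxiAcc L N R' y j0 d * piTv L N R' (bpt L N y j0) μ (L - 1)) * R' (bpt L N y j) μ := by
    rw [hlast]; simp only [sub_mul, mul_assoc]; abel
  rw [e]
  have hL1 : ((L - 1 : ℕ) : ℝ) * (((d - 1 : ℕ) : ℝ) * ((L - 1 : ℕ) : ℝ) * a) * 1 + ((d - 1 : ℕ) : ℝ) * ((L : ℝ) * ((L - 1 : ℕ) : ℝ) * a)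
      = ((d - 1 : ℕ) : ℝ) * ((L - 1 : ℕ) : ℝ) * ((2 * L - 1 : ℕ) : ℝ) * a := by
    have hL : ((2 * L - 1 : ℕ) : ℝ) = ((L - 1 : ℕ) : ℝ) + L := by
      have := NeZero.pos L
      rw [show 2 * L - 1 = (L - 1) + L by omega]; push_cast; ring
    rw [hL]; ring
  calc _ ≤ ‖piTv L N R' (bpt L N y 0) μ L * taxiAcc L N R' (y + unitVec N μ) j0 d - taxiAcc L N R' y j0 d * piTv L N R' (bpt L N y j0) μ L‖
        + ‖(taxiAcc L N R' y j d - taxiAcc L N R' y j0 d * piTv L N R' (bpt L N y j0) μ (L - 1)) * R' (bpt L N y j) μ‖ := norm_sub_le _ _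
    _ ≤ ((d - 1 : ℕ) : ℝ) * ((L : ℝ) * ((L - 1 : ℕ) : ℝ) * a) + ((L - 1 : ℕ) : ℝ) * (((d - 1 : ℕ) : ℝ) * ((L - 1 : ℕ) : ℝ) * a) * 1 :=
        add_le_add hrun ((norm_mul_le _ _).trans (mul_le_mul hsteps (hR' _ _) (norm_nonneg _) (by positivity)))
    _ = _ := by rw [← hL1]; ring

omit hN in
/-- **THE COARSE PLAQUETTE DEFECT** (the class propagates along the tower): the straight coarsening has operator plaquette defect `≤ L·L·a` — an `L × L`
rectangle of fine plaquettes (`norm_piTv_comm_sub_le`); under the scale-invariant class `(nL)²·a ≤ c` the coarse data satisfy `n²·(L²a) ≤ c`. [folklore] -/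
theorem coarseTv_plaq_le (y : Tor N) (μ ν : Fin d) :
    ‖coarseTv L N R' y μ * coarseTv L N R' (y + unitVec N μ) ν - coarseTv L N R' y ν * coarseTv L N R' (y + unitVec N ν) μ‖ ≤ (L : ℝ) * L * a := by
  unfold coarseTv
  rw [← bpt_add_tstep L N y 0 μ, ← bpt_add_tstep L N y 0 ν]
  exact norm_piTv_comm_sub_le L N hR' ha (bpt L N y 0) μ ν L L

end Steps

/-! ## §3 Bałaban's product line transports against the frame-adapted ones, at taxi data -/

section Lines

variable (L : ℕ) [NeZero L] (N : Fin d → ℕ) [hN : ∀ μ, NeZero (N μ)]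
variable {R' : Tor (fine L N) → Fin d → (E →L[ℂ] E)} (hR' : ∀ x μ, ‖R' x μ‖ ≤ 1) {a : ℝ}
  (ha : ∀ x κ ι, ‖R' x κ * R' (x + unitVec (fine L N) κ) ι - R' x ι * R' (x + unitVec (fine L N) ι) κ‖ ≤ a)
include hR' ha

/-- **OWN LINES**: on a point of its own block the product line transport is the point's taxi frame up to `t·(d−1)(L−1)·a ≤ (d−1)L(L−1)·a`:
`j_ν + t < L → ‖lineT (taxiTv R′) R′ y j t ν − taxiTv R′ (L·y + j + t e_ν)‖ ≤ (d−1)·L·(L−1)·a`. [folklore] -/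
theorem lineT_taxi_own_sub_le (y : Tor N) (j : Fin d → Fin L) (t : Fin L) (ν : Fin d) (ht : (j ν : ℕ) + t < L) :
    ‖lineT L N (taxiTv L N R') R' y j t ν - taxiTv L N R' (bpt L N y j + tstep (fine L N) ν t)‖
      ≤ ((d - 1 : ℕ) : ℝ) * L * ((L - 1 : ℕ) : ℝ) * a := by
  have ha0 : 0 ≤ a := (norm_nonneg _).trans (ha (bpt L N y j) ν ν)
  have h := taxiTv_steps_sub_le L N hR' ha y j ν t ht
  rw [norm_sub_rev] at h
  refine h.trans ?_
  have htL : ((t : ℕ) : ℝ) ≤ L := by exact_mod_cast t.is_lt.le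
  have h0 : 0 ≤ ((d - 1 : ℕ) : ℝ) * ((L - 1 : ℕ) : ℝ) * a := by positivity
  nlinarith

/-- **SPILL LINES**: on a point of the next block the product line transport is the COARSE BOND after the point's taxi frame, up to `3·(d−1)L(L−1)·a`:
`L ≤ j_ν + t → ‖lineT (taxiTv R′) R′ y j t ν − coarseTv R′ y ν ∘ taxiTv R′ (L·y + j + t e_ν)‖ ≤ 3·(d−1)·L·(L−1)·a` (`j_ν` steps back to `j[ν ↦ 0]`, part 1's
`L`-run across the taxi, `j_ν + t − L` steps forward in the next block). [folklore] -/
theorem lineT_taxi_spill_sub_le (y : Tor N) (j : Fin d → Fin L) (t : Fin L) (ν : Fin d) (ht : L ≤ (j ν : ℕ) + t) :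
    ‖lineT L N (taxiTv L N R') R' y j t ν - coarseTv L N R' y ν * taxiTv L N R' (bpt L N y j + tstep (fine L N) ν t)‖
      ≤ 3 * (((d - 1 : ℕ) : ℝ) * L * ((L - 1 : ℕ) : ℝ) * a) := by
  have ha0 : 0 ≤ a := (norm_nonneg _).trans (ha (bpt L N y j) ν ν)
  set w₀ : ℝ := ((d - 1 : ℕ) : ℝ) * ((L - 1 : ℕ) : ℝ) * a with hw₀
  have hw0 : 0 ≤ w₀ := by positivity
  set j0 : Fin d → Fin L := Function.update j ν 0 with hj0
  set s : ℕ := (j ν : ℕ) + t - L with hs_def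
  have hsL : s < L := by have := t.is_lt; omega
  have hj0ν : (j0 ν : ℕ) = 0 := by simp [hj0]
  -- points
  have hb : bpt L N y j = bpt L N y j0 + tstep (fine L N) ν (j ν : ℕ) := bpt_eq_update_zero_add L N y j ν
  have hnext : bpt L N y j0 + tstep (fine L N) ν L = bpt L N (y + unitVec N ν) j0 := bpt_add_tstep L N y j0 ν
  have hp : bpt L N y j + tstep (fine L N) ν t = bpt L N (y + unitVec N ν) j0 + tstep (fine L N) ν s := by
    rw [hb, ← hnext, add_assoc, add_assoc, ← VectorBlockTrialForm.tstep_add, ← VectorBlockTrialForm.tstep_add]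
    congr 2; omega
  -- (i) `j_ν` steps back inside block `y`
  have h1 := taxiTv_steps_sub_le L N hR' ha y j0 ν (j ν : ℕ) (by rw [hj0ν, zero_add]; exact (j ν).is_lt)
  rw [← hb] at h1
  -- (ii) the `L`-run across the taxi at digits `j0`
  have h2 := coarse_mul_taxiAcc_sub_le L N hR' ha y j0 ν le_rfl
  rw [if_pos ν.is_lt, corner_d, ← taxiTv_bpt, ← taxiTv_bpt, norm_sub_rev] at h2
  -- (iii) `s` steps forward inside block `y + e_ν`
  have h3 := taxiTv_steps_sub_le L N hR' ha (y + unitVec N ν) j0 ν s (by rw [hj0ν, zero_add]; exact hsL)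
  rw [← hp] at h3
  -- the straight transporter of the line, split twice
  have hsplit : piTv L N R' (bpt L N y j0) ν (j ν : ℕ) * piTv L N R' (bpt L N y j) ν t
      = piTv L N R' (bpt L N y j0) ν L * piTv L N R' (bpt L N (y + unitVec N ν) j0) ν s := by
    rw [hb, ← piTv_add, show (j ν : ℕ) + (t : ℕ) = L + s by omega, piTv_add, hnext]
  unfold lineT coarseTv
  -- telescope through the three intermediate transports
  have e : taxiTv L N R' (bpt L N y j) * piTv L N R' (bpt L N y j) ν t
        - piTv L N R' (bpt L N y 0) ν L * taxiTv L N R' (bpt L N y j + tstep (fine L N) ν t)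
      = (taxiTv L N R' (bpt L N y j) - taxiTv L N R' (bpt L N y j0) * piTv L N R' (bpt L N y j0) ν (j ν : ℕ)) * piTv L N R' (bpt L N y j) ν t
        + (taxiTv L N R' (bpt L N y j0) * piTv L N R' (bpt L N y j0) ν L - piTv L N R' (bpt L N y 0) ν L * taxiTv L N R' (bpt L N (y + unitVec N ν) j0))
          * piTv L N R' (bpt L N (y + unitVec N ν) j0) ν s
        - piTv L N R' (bpt L N y 0) ν L * (taxiTv L N R' (bpt L N y j + tstep (fine L N) ν t)
          - taxiTv L N R' (bpt L N (y + unitVec N ν) j0) * piTv L N R' (bpt L N (y + unitVec N ν) j0) ν s) := by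
    simp only [sub_mul, mul_sub, mul_assoc, hsplit]; abel
  rw [e]
  have hjν : ((j ν : ℕ) : ℝ) ≤ L := by exact_mod_cast (j ν).is_lt.le
  have hsl : (s : ℝ) ≤ L := by exact_mod_cast hsL.le
  calc _ ≤ ‖(taxiTv L N R' (bpt L N y j) - taxiTv L N R' (bpt L N y j0) * piTv L N R' (bpt L N y j0) ν (j ν : ℕ)) * piTv L N R' (bpt L N y j) ν t‖
        + ‖(taxiTv L N R' (bpt L N y j0) * piTv L N R' (bpt L N y j0) ν L - piTv L N R' (bpt L N y 0) ν L * taxiTv L N R' (bpt L N (y + unitVec N ν) j0))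
          * piTv L N R' (bpt L N (y + unitVec N ν) j0) ν s‖
        + ‖piTv L N R' (bpt L N y 0) ν L * (taxiTv L N R' (bpt L N y j + tstep (fine L N) ν t)
          - taxiTv L N R' (bpt L N (y + unitVec N ν) j0) * piTv L N R' (bpt L N (y + unitVec N ν) j0) ν s)‖ := norm_sub_le_of_le (norm_add_le _ _) le_rfl
    _ ≤ (j ν : ℕ) * w₀ * 1 + ((d - 1 : ℕ) : ℝ) * ((L : ℝ) * ((L - 1 : ℕ) : ℝ) * a) * 1 + 1 * (s * w₀) := by
        refine add_le_add (add_le_add ?_ ?_) ?_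
        · exact (norm_mul_le _ _).trans (mul_le_mul h1 (norm_piTv_le_one L N hR' _ _ _) (norm_nonneg _) (by positivity))
        · exact (norm_mul_le _ _).trans (mul_le_mul h2 (norm_piTv_le_one L N hR' _ _ _) (norm_nonneg _) (by positivity))
        · exact (norm_mul_le _ _).trans (mul_le_mul (norm_piTv_le_one L N hR' _ _ _) h3 (norm_nonneg _) zero_le_one)
    _ ≤ 3 * (((d - 1 : ℕ) : ℝ) * L * ((L - 1 : ℕ) : ℝ) * a) := by rw [hw₀]; nlinarith

end Lines

/-! ## §4 Unitary data: the in-block ∕ crossing binders of UB⁺-colour and ONE⁺-colour in their own letters -/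

section Unitary

variable (L : ℕ) [NeZero L] (N : Fin d → ℕ) [hN : ∀ μ, NeZero (N μ)]
variable {H : Type*} [NormedAddCommGroup H] [InnerProductSpace ℂ H] [CompleteSpace H]
variable {R' : Tor (fine L N) → Fin d → (H →L[ℂ] H)} (hU : ∀ x μ, R' x μ ∈ unitary (H →L[ℂ] H)) {a : ℝ}
  (ha : ∀ x κ ι, ‖R' x κ * R' (x + unitVec (fine L N) κ) ι - R' x ι * R' (x + unitVec (fine L N) ι) κ‖ ≤ a)

include hU ha

/-- **UB⁺-COLOUR's `hw` AT TAXI DATA** (`T := taxiTv R′`, right inverse `S := (taxiTv R′)⋆`):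
`j_μ + 1 < L → ‖R′(x,μ) ∘ (taxiTv R′ (x+e_μ))⋆ ∘ taxiTv R′ x − 1‖ ≤ (d−1)(L−1)·a` (`U S₁ T₀ − 1 = U S₁ (T₀ U − T₁) U⋆`). [folklore] -/
theorem inBlock_defect_taxiTv_adjoint_le (y : Tor N) (j : Fin d → Fin L) (μ : Fin d) (h : (j μ : ℕ) + 1 < L) :
    ‖R' (bpt L N y j) μ * star (taxiTv L N R' (bpt L N y j + unitVec (fine L N) μ)) * taxiTv L N R' (bpt L N y j) - 1‖
      ≤ ((d - 1 : ℕ) : ℝ) * ((L - 1 : ℕ) : ℝ) * a := by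
  have hR' : ∀ x μ, ‖R' x μ‖ ≤ 1 := fun x μ => norm_le_one_of_mem_unitary (hU x μ)
  have hstep := inBlock_defect_taxiTv_le L N hR' ha y j μ h
  set U := R' (bpt L N y j) μ
  set T₁ := taxiTv L N R' (bpt L N y j + unitVec (fine L N) μ)
  set T₀ := taxiTv L N R' (bpt L N y j)
  have hUu : U ∈ unitary (H →L[ℂ] H) := hU _ _
  have hT₁ : T₁ ∈ unitary (H →L[ℂ] H) := taxiTv_mem_unitary L N hU _
  have e : U * star T₁ * T₀ - 1 = U * star T₁ * (T₀ * U - T₁) * star U := by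
    have h1 : star T₁ * T₁ = 1 := Unitary.star_mul_self_of_mem hT₁
    have h2 : U * star U = 1 := Unitary.mul_star_self_of_mem hUu
    calc U * star T₁ * T₀ - 1 = U * star T₁ * T₀ * (U * star U) - U * (star T₁ * T₁) * star U := by rw [h1, mul_one, h2, mul_one]
      _ = _ := by simp only [mul_sub, sub_mul, mul_assoc]
  rw [e]
  calc ‖U * star T₁ * (T₀ * U - T₁) * star U‖ = ‖U * (star T₁ * (T₀ * U - T₁))‖ := by
          rw [CStarRing.norm_mul_mem_unitary _ (Unitary.star_mem hUu), mul_assoc]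
    _ = ‖T₀ * U - T₁‖ := by rw [CStarRing.norm_mem_unitary_mul _ hUu, CStarRing.norm_mem_unitary_mul _ (Unitary.star_mem hT₁)]
    _ ≤ _ := by rw [norm_sub_rev]; exact hstep

/-- **ONE⁺-COLOUR's `hin` AT TAXI DATA** (star letters of `VariationalColourOneStep.sum_dirUv_interpv_le`):
`j_μ + 1 < L → ‖R′(x,μ) ∘ (taxiTv R′ (x+e_μ))⋆ − (taxiTv R′ x)⋆‖ ≤ (d−1)(L−1)·a`. [folklore] -/
theorem hin_taxiTv_le (y : Tor N) (j : Fin d → Fin L) (μ : Fin d) (h : (j μ : ℕ) + 1 < L) :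
    ‖R' (bpt L N y j) μ * star (taxiTv L N R' (bpt L N y j + unitVec (fine L N) μ)) - star (taxiTv L N R' (bpt L N y j))‖
      ≤ ((d - 1 : ℕ) : ℝ) * ((L - 1 : ℕ) : ℝ) * a := by
  have hR' : ∀ x μ, ‖R' x μ‖ ≤ 1 := fun x μ => norm_le_one_of_mem_unitary (hU x μ)
  have hstep := inBlock_defect_taxiTv_le L N hR' ha y j μ h
  set U := R' (bpt L N y j) μ
  set T₁ := taxiTv L N R' (bpt L N y j + unitVec (fine L N) μ)
  set T₀ := taxiTv L N R' (bpt L N y j)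
  have hUu : U ∈ unitary (H →L[ℂ] H) := hU _ _
  -- `U T₁⋆ − T₀⋆ = U (T₁ − T₀ U)⋆`
  have e : U * star T₁ - star T₀ = U * star (T₁ - T₀ * U) := by
    rw [star_sub, star_mul, mul_sub, ← mul_assoc, Unitary.mul_star_self_of_mem hUu, one_mul]
  rw [e, CStarRing.norm_mem_unitary_mul _ hUu, norm_star]
  exact hstep

/-- **ONE⁺-COLOUR's `hcross` AT TAXI DATA** (`Rc := coarseTv R′`):
`j_μ + 1 = L → ‖R′(x,μ) ∘ (taxiTv R′ (x+e_μ))⋆ − (taxiTv R′ x)⋆ ∘ coarseTv R′ y μ‖ ≤ (d−1)(L−1)(2L−1)·a`. [folklore] -/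
theorem hcross_taxiTv_le (y : Tor N) (j : Fin d → Fin L) (μ : Fin d) (h : (j μ : ℕ) + 1 = L) :
    ‖R' (bpt L N y j) μ * star (taxiTv L N R' (bpt L N y j + unitVec (fine L N) μ)) - star (taxiTv L N R' (bpt L N y j)) * coarseTv L N R' y μ‖
      ≤ ((d - 1 : ℕ) : ℝ) * ((L - 1 : ℕ) : ℝ) * ((2 * L - 1 : ℕ) : ℝ) * a := by
  have hR' : ∀ x μ, ‖R' x μ‖ ≤ 1 := fun x μ => norm_le_one_of_mem_unitary (hU x μ)
  have hx := cross_defect_taxiTv_le L N hR' ha y j μ h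
  set U := R' (bpt L N y j) μ
  set T₁ := taxiTv L N R' (bpt L N y j + unitVec (fine L N) μ)
  set T₀ := taxiTv L N R' (bpt L N y j)
  set C := coarseTv L N R' y μ
  have hT₁ : T₁ ∈ unitary (H →L[ℂ] H) := taxiTv_mem_unitary L N hU _
  have hT₀ : T₀ ∈ unitary (H →L[ℂ] H) := taxiTv_mem_unitary L N hU _
  -- `U T₁⋆ − T₀⋆ C = T₀⋆ (T₀ U − C T₁) T₁⋆`
  have e : U * star T₁ - star T₀ * C = star T₀ * (T₀ * U - C * T₁) * star T₁ := by
    have h0 : star T₀ * T₀ = 1 := Unitary.star_mul_self_of_mem hT₀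
    have h1 : T₁ * star T₁ = 1 := Unitary.mul_star_self_of_mem hT₁
    calc U * star T₁ - star T₀ * C = (star T₀ * T₀) * U * star T₁ - star T₀ * C * (T₁ * star T₁) := by rw [h0, h1, one_mul, mul_one]
      _ = _ := by simp only [mul_sub, sub_mul, mul_assoc]
  rw [e, CStarRing.norm_mul_mem_unitary _ (Unitary.star_mem hT₁), CStarRing.norm_mem_unitary_mul _ (Unitary.star_mem hT₀), norm_sub_rev]
  exact hx

end Unitary

end Summit.QuantumFields.BalabanUV.T4Continuum.VariationalColourTaxiTransport

end
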